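import Summits.ResolutionOfSingularities.ResolutionOfSingularities.Theorems.EquisingularLiftEquisingularLiftNatTowerCechRoundCloserV3
import Summits.ResolutionOfSingularities.ResolutionOfSingularities.Theorems.EquisingularLiftEquisingularLiftNatTowerCechCentre
import HarnessLib

/-!
# [OURS · L1 W4.5(b) · EL♮(3)] HSUB′(ReachTower₃) — THE ASSEMBLY'S STAND-IN S6 `hCech`, CLOSED MODULO (N1) / (N3) / (N3′) / S2 — v2, closer at the ROOT
# (= …NatTowerCechRoundCloser with the round's data `Z ⊆ E ∩ T`, `Z ≠ ∅`, `TowerFull`, `¬ T ⊆ E` ADDED to (N1)'s antecedents, so that (N1) is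
# dischargeable: …NatTowerCechCentre's `Tower.hCentre_of_root` produces exactly this (N1) from a centre at the root of `DirLift.Ruled`)
# (res-D-pv-029's `hCech` binder of `D/res-D-pv-029/gen8/TowerAssembly.lean` = the S6 STATEMENT OF RECORD, res-L1-w45b-plan-1 2026-08-27T20:21:03Z (2))

res-D-pv-057 g9 AS a w45b hand. OURS; NOT a statement of any manuscript; AI-written, weaker than expert review. No `sorry`; standard axioms. DEF-FREE.
`--supports stmt-ResolutionOfSingularities-20148 --as helper`. Closer-modulo pattern (like p564140): the conclusion of **`Tower.hCech_of`** is the `hCech`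
binder of the assembly `hsub_reachTower_three_of` VERBATIM, so the assembly may pass `Tower.hCech_of₃ … hCentre hShadow hShadowOld hRootRound` in its slot
(v1 `Tower.hCech_of`, p569903, has the same conclusion but an (N1) WITHOUT the round's data among its antecedents — too strong to discharge, superseded here);
the four remaining hypotheses are
* (N1) `hCentre` — the Čech centre `𝒞 = 𝓔 ⊔ 𝒦₁` at a Čech-witnessed stage (res-L1-w45b-stub-2's S6 decomposition (a)–(d), next file `…NatTransportedCentre`
  over T-DIRLIFT / DIRDICT (a) / T-DIRLIFT-UP / T-CENTRE-2FRAME / the bridge p567357);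
* (N3) `hShadow`, (N3′) `hShadowOld` — the transported shadow `St_𝒞 𝒦` next to the new / old surface after a Čech round OFF the shadow
  (`closure (Z ∖ closure K) = Z`; (k-ii)–(k-vi) of `Tower.Shadow₂`; owner res-D-pv-051 / stub-2);
* S2 `hRootRound` — the assembly's own stand-in (ruled-surface datum born at a CONE round), used only in the cone-witnessed sub-case of the driver's `K′`
  menu, which is dispatched to res-D-pv-029's `Tower.inv₂_coneRound_new` / `_old` (p558403 / p560701) with stub-2's S4/S5 (p564910) discharging their
  `hRuled` / `hEZ`.
Everything else — the two `Tower.Inv₂` conclusions (…NatTowerCechRound / …NatTowerCechRoundOld) and the downstairs side facts of `K′` (res-D-pv-029's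
…NatTowerSideFacts) — is in the tree.
-/

set_option linter.dupNamespace false -- mandated namespace `Summit.<Summit>.<Problem>` of this single-conjunct summit
set_option linter.overlappingInstances false -- signatures carry `[IsDomain O] [IsDiscreteValuationRing O]`

noncomputable section

open CategoryTheory CategoryTheory.Limits AlgebraicGeometry TopologicalSpace Topology IsLocalRing
open Literature.AlgebraicGeometry.Resolution
open Literature.AlgebraicGeometry.Morphisms (ProjCech.PP ProjCech.toSpec)
open AlgebraicGeometry.Scheme.IdealSheafData
open Summit.ResolutionOfSingularities.ResolutionOfSingularities.Theses.EquisingularLift.Split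
open Summit.ResolutionOfSingularities.ResolutionOfSingularities.Cruxes.EquisingularLift.StrataSplit

namespace Summit.ResolutionOfSingularities.ResolutionOfSingularities.Cruxes.EquisingularLiftNat.Sections

set_option maxHeartbeats 1600000 in -- long binder texts
/-- **S6 `hCech` closed modulo the ROOT-LEVEL centre (N1°), the two shadow stand-ins (N3)/(N3′) and S2**: `Tower.hCech_of₃` with (N1) supplied by
…NatTowerCechCentre's `Tower.hCentre_of_root`. [OURS · L1 W4.5b] toward `stub_elnat_coneTowerPointResolution` (stmt-ResolutionOfSingularities-20148 /
-20038); NOT a statement of the manuscript. -/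
theorem Tower.hCech_of_root (O : Type) [CommRing O] [IsDomain O] [IsDiscreteValuationRing O] (k : Type) [Field k]
    (θ : O →+* k) (hθ : Function.Surjective θ)
    (P : Scheme.{0}) (q : P ⟶ Spec (.of O)) (hqprop : IsProper q) (Y : Set P) (hYirr : IsIrreducible Y) (hYcl : IsClosed Y)
    (hPnoeth : IsLocallyNoetherian P) (hPreg : Scheme.IsRegular P)
    (Ch : ∀ X' : Scheme.{0}, (X' ⟶ P) → Set X' → Prop)
    (hChain : ∀ (X' : Scheme.{0}) (σ : X' ⟶ P) (S : Set X'), Ch X' σ S → Chain P Y X' σ S)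
    (hStep : ∀ (X' X'' : Scheme.{0}) (σ' : X' ⟶ P) (S' : Set X') (C : X'.IdealSheafData) (τ : X'' ⟶ X'),
      Ch X' σ' S' → IsBlowup τ C → Scheme.IsRegular C.subscheme → Flat (C.subschemeι ≫ σ' ≫ q) →
      σ' '' (C.support : Set X') ⊆ {x : P | ¬ IsGenericPoint x Y} →
      (C.support : Set X') ∩ (σ' ≫ q) ⁻¹' {IsLocalRing.closedPoint O} ⊆ S' →
      Ch X'' (τ ≫ σ') (closure (τ ⁻¹' (S' \ (C.support : Set X')))))
    (hRootCentre : ∀ {F₉ : Scheme.{0}} (Z₉ : Set F₉) (hZ₉ : IsClosed Z₉) {F₁₀ : Scheme.{0}} (υ' : F₁₀ ⟶ F₉)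
        (G : Scheme.{0}) (γ : G ⟶ F₁₀) (E : Set G) (hE : IsClosed E) (Z : Set G) (hZ : IsClosed Z),
        DirStepSec F₉ F₁₀ υ' Z₉ hZ₉ G γ Z hZ → RationalCarrier (redSub F₉ Z₉ hZ₉) →
        (∀ x : redSub G Z hZ, IsRegularLocalRing (G.presheaf.stalk (redSubι G Z hZ x))) →
        (∀ (i : redSub G Z hZ ⟶ redSub G E hE), i ≫ redSubι G E hE = redSubι G Z hZ →
          ∀ x : redSub G Z hZ, IsRegularLocalRing ((redSub G E hE).presheaf.stalk (i x))) →
        DirStepUnobs G E hE Z hZ → Z ⊆ E →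
        -- the stage and its exceptional surface
        ∀ (X : Scheme.{0}) (σ : X ⟶ P) (jG : G ⟶ X) (tG : G ⟶ Spec (.of k)) (𝓔 : X.IdealSheafData),
        IsIntegral X → IsLocallyNoetherian X → Scheme.IsRegular X →
        IsPullback jG tG (σ ≫ q) (Spec.map (CommRingCat.ofHom θ)) →
        𝓔.comap jG = vanishingIdeal ⟨E, hE⟩ → (∀ z : X, (stalkIdeal 𝓔 z).IsPrincipal) → Scheme.IsRegular 𝓔.subscheme →
        -- the root of `DirLift.Ruled` (R1)–(R4), unpacked
        ∀ (X₀ : Scheme.{0}) (σ₀ : X₀ ⟶ P) (I : X₀.IdealSheafData) (X₁ : Scheme.{0}) (τ₀ : X₁ ⟶ X₀) (ρ : X ⟶ X₁)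
          (G₀ : Scheme.{0}) (j₀ : G₀ ⟶ X₀) (t₀ : G₀ ⟶ Spec (.of k)) (γ₀ : G₀ ⟶ F₉)
          (G₁ : Scheme.{0}) (j₁ : G₁ ⟶ X₁) (t₁ : G₁ ⟶ Spec (.of k)) (υ₁ : G₁ ⟶ G₀) (ϱ : G ⟶ G₁)
          (e : 𝓔.subscheme ≅ (I.comap τ₀).subscheme) (Z₀ : Set G₀) (hZ₀ : IsClosed Z₀) (δ₀ : redSub G₀ Z₀ hZ₀ ⟶ redSub F₉ Z₉ hZ₉),
        IsIntegral X₀ → IsLocallyNoetherian X₀ → Scheme.IsRegular X₀ → IsBlowup τ₀ I → σ = (ρ ≫ τ₀) ≫ σ₀ →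
        e.hom ≫ (I.comap τ₀).subschemeι = 𝓔.subschemeι ≫ ρ →
        IsPullback j₀ t₀ (σ₀ ≫ q) (Spec.map (CommRingCat.ofHom θ)) → IsPullback j₁ t₁ ((τ₀ ≫ σ₀) ≫ q) (Spec.map (CommRingCat.ofHom θ)) →
        j₁ ≫ τ₀ = υ₁ ≫ j₀ → IsBlowup υ₁ (I.comap j₀) → jG ≫ ρ = ϱ ≫ j₁ → ϱ ≫ υ₁ ≫ γ₀ = γ ≫ υ' →
        I.comap j₀ = vanishingIdeal ⟨Z₀, hZ₀⟩ → δ₀ ≫ redSubι F₉ Z₉ hZ₉ = redSubι G₀ Z₀ hZ₀ ≫ γ₀ → IsIso δ₀ →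
        Scheme.IsRegular I.subscheme → Flat (I.subschemeι ≫ σ₀ ≫ q) → σ₀ '' (I.support : Set X₀) ⊆ {p : P | ¬ IsGenericPoint p Y} →
        (∀ x ∈ I.support, ∃ c : Fin 2 → X₀.presheaf.stalk x, Ideal.span (Set.range c) = stalkIdeal I x ∧ IsQuasiRegular c) →
        (RationalCarrier (redSub F₉ Z₉ hZ₉) → ∃ e₁ : I.subscheme ≅ ProjCech.PP O 1, e₁.hom ≫ ProjCech.toSpec O 1 = I.subschemeι ≫ σ₀ ≫ q) →
        ∃ (C₁ : X₁.IdealSheafData) (Γ₁ : Set G₁) (hΓ₁ : IsClosed Γ₁),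
          I.comap τ₀ ≤ C₁ ∧ Scheme.IsRegular C₁.subscheme ∧ Flat (C₁.subschemeι ≫ (τ₀ ≫ σ₀) ≫ q) ∧
          IsEffectiveCartier (C₁.comap (I.comap τ₀).subschemeι) ∧
          C₁.comap j₁ = vanishingIdeal ⟨Γ₁, hΓ₁⟩ ∧ E ∩ ϱ ⁻¹' Γ₁ = Z ∧
          (RationalCarrier (redSub F₉ Z₉ hZ₉) →
            ∃ e₁ : C₁.subscheme ≅ ProjCech.PP O 1, e₁.hom ≫ ProjCech.toSpec O 1 = C₁.subschemeι ≫ (τ₀ ≫ σ₀) ≫ q))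
    -- (N3) the transported shadow next to the NEW surface, off the shadow
    (hShadow : ∀ {F₉ : Scheme.{0}} (Z₉ : Set F₉) (hZ₉ : IsClosed Z₉) {F₁₀ : Scheme.{0}} (υ' : F₁₀ ⟶ F₉)
        (G G' : Scheme.{0}) (γ : G ⟶ F₁₀) (T E K : Set G) (hE : IsClosed E) (Z : Set G) (hZ : IsClosed Z) (υ₂ : G' ⟶ G),
        DirStepSec F₉ F₁₀ υ' Z₉ hZ₉ G γ Z hZ → IsBlowup υ₂ (vanishingIdeal ⟨Z, hZ⟩) →
        ∀ (X : Scheme.{0}) (σ : X ⟶ P) (S : Set X) (jG : G ⟶ X) (tG : G ⟶ Spec (.of k)) (𝓔 𝒦 𝒦₁ : X.IdealSheafData)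
        (X₂ : Scheme.{0}) (τ : X₂ ⟶ X) (j₂ : G' ⟶ X₂) (t₂ : G' ⟶ Spec (.of k)),
        Ch X σ S → IsIntegral X → IsLocallyNoetherian X → Scheme.IsRegular X → IsDominant (σ ≫ q) →
        IsPullback jG tG (σ ≫ q) (Spec.map (CommRingCat.ofHom θ)) → jG '' T = S →
        𝓔.comap jG = vanishingIdeal ⟨E, hE⟩ → (∀ z : X, (stalkIdeal 𝓔 z).IsPrincipal) → Scheme.IsRegular 𝓔.subscheme →
        (∀ z : X, (stalkIdeal 𝒦 z).IsPrincipal) → 𝒦.comap jG = vanishingIdeal (⟨closure K, isClosed_closure⟩ : Closeds G) →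
        Flat ((𝓔 ⊔ 𝒦).subschemeι ≫ σ ≫ q) → IsEffectiveCartier (𝓔.comap 𝒦.subschemeι) → IsEffectiveCartier (𝒦.comap 𝓔.subschemeι) →
        (𝓔 ⊔ 𝒦₁).comap jG = vanishingIdeal ⟨Z, hZ⟩ → Flat ((𝓔 ⊔ 𝒦₁).subschemeι ≫ σ ≫ q) → Scheme.IsRegular (𝓔 ⊔ 𝒦₁).subscheme →
        IsEffectiveCartier (𝒦₁.comap 𝓔.subschemeι) →
        IsBlowup τ (𝓔 ⊔ 𝒦₁) → IsPullback j₂ t₂ ((τ ≫ σ) ≫ q) (Spec.map (CommRingCat.ofHom θ)) → j₂ ≫ τ = υ₂ ≫ jG →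
        IsClosed K → K ⊆ closure (K \ E) → K ≠ Set.univ → closure (Z \ closure K) = Z →
        (strictTransformIdeal τ (𝓔 ⊔ 𝒦₁) 𝒦).comap j₂ =
            vanishingIdeal (⟨closure (closure (υ₂ ⁻¹' (K \ Z))), isClosed_closure⟩ : Closeds G') ∧
          Flat ((((𝓔 ⊔ 𝒦₁).comap τ) ⊔ strictTransformIdeal τ (𝓔 ⊔ 𝒦₁) 𝒦).subschemeι ≫ (τ ≫ σ) ≫ q) ∧
          (∀ (hE' : IsClosed (υ₂ ⁻¹' Z)) (y : G'),
            j₂ y ∈ ((((𝓔 ⊔ 𝒦₁).comap τ) ⊔ strictTransformIdeal τ (𝓔 ⊔ 𝒦₁) 𝒦).support : Set X₂) →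
            stalkIdeal (vanishingIdeal (⟨υ₂ ⁻¹' Z, hE'⟩ : Closeds G') ⊔
              vanishingIdeal (⟨closure (closure (υ₂ ⁻¹' (K \ Z))), isClosed_closure⟩ : Closeds G')) y =
            stalkIdeal (vanishingIdeal (⟨υ₂ ⁻¹' Z ∩ closure (closure (υ₂ ⁻¹' (K \ Z))), hE'.inter isClosed_closure⟩ : Closeds G')) y →
            IsRegularLocalRing (X₂.presheaf.stalk (j₂ y) ⧸
              stalkIdeal (((𝓔 ⊔ 𝒦₁).comap τ) ⊔ strictTransformIdeal τ (𝓔 ⊔ 𝒦₁) 𝒦) (j₂ y))) ∧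
          IsEffectiveCartier (((𝓔 ⊔ 𝒦₁).comap τ).comap (strictTransformIdeal τ (𝓔 ⊔ 𝒦₁) 𝒦).subschemeι) ∧
          IsEffectiveCartier ((strictTransformIdeal τ (𝓔 ⊔ 𝒦₁) 𝒦).comap ((𝓔 ⊔ 𝒦₁).comap τ).subschemeι))
    -- (N3′) the transported shadow next to the OLD surface, off the shadow
    (hShadowOld : ∀ {F₉ : Scheme.{0}} (Z₉ : Set F₉) (hZ₉ : IsClosed Z₉) {F₁₀ : Scheme.{0}} (υ' : F₁₀ ⟶ F₉)
        (G G' : Scheme.{0}) (γ : G ⟶ F₁₀) (T E K : Set G) (hE : IsClosed E) (Z : Set G) (hZ : IsClosed Z) (υ₂ : G' ⟶ G),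
        DirStepSec F₉ F₁₀ υ' Z₉ hZ₉ G γ Z hZ → IsBlowup υ₂ (vanishingIdeal ⟨Z, hZ⟩) →
        ∀ (X : Scheme.{0}) (σ : X ⟶ P) (S : Set X) (jG : G ⟶ X) (tG : G ⟶ Spec (.of k)) (𝓔 𝒦 𝒦₁ : X.IdealSheafData)
        (X₂ : Scheme.{0}) (τ : X₂ ⟶ X) (j₂ : G' ⟶ X₂) (t₂ : G' ⟶ Spec (.of k)),
        Ch X σ S → IsIntegral X → IsLocallyNoetherian X → Scheme.IsRegular X → IsDominant (σ ≫ q) →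
        IsPullback jG tG (σ ≫ q) (Spec.map (CommRingCat.ofHom θ)) → jG '' T = S →
        𝓔.comap jG = vanishingIdeal ⟨E, hE⟩ → (∀ z : X, (stalkIdeal 𝓔 z).IsPrincipal) → Scheme.IsRegular 𝓔.subscheme →
        (∀ z : X, (stalkIdeal 𝒦 z).IsPrincipal) → 𝒦.comap jG = vanishingIdeal (⟨closure K, isClosed_closure⟩ : Closeds G) →
        Flat ((𝓔 ⊔ 𝒦).subschemeι ≫ σ ≫ q) → IsEffectiveCartier (𝓔.comap 𝒦.subschemeι) → IsEffectiveCartier (𝒦.comap 𝓔.subschemeι) →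
        (𝓔 ⊔ 𝒦₁).comap jG = vanishingIdeal ⟨Z, hZ⟩ → Flat ((𝓔 ⊔ 𝒦₁).subschemeι ≫ σ ≫ q) → Scheme.IsRegular (𝓔 ⊔ 𝒦₁).subscheme →
        IsEffectiveCartier (𝒦₁.comap 𝓔.subschemeι) →
        IsBlowup τ (𝓔 ⊔ 𝒦₁) → IsPullback j₂ t₂ ((τ ≫ σ) ≫ q) (Spec.map (CommRingCat.ofHom θ)) → j₂ ≫ τ = υ₂ ≫ jG →
        IsClosed K → K ⊆ closure (K \ E) → K ≠ Set.univ → closure (Z \ closure K) = Z →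
        (strictTransformIdeal τ (𝓔 ⊔ 𝒦₁) 𝒦).comap j₂ =
            vanishingIdeal (⟨closure (closure (υ₂ ⁻¹' (K \ Z))), isClosed_closure⟩ : Closeds G') ∧
          Flat ((strictTransformIdeal τ (𝓔 ⊔ 𝒦₁) 𝓔 ⊔ strictTransformIdeal τ (𝓔 ⊔ 𝒦₁) 𝒦).subschemeι ≫ (τ ≫ σ) ≫ q) ∧
          (∀ (hE' : IsClosed (closure (υ₂ ⁻¹' (E \ Z)))) (y : G'),
            j₂ y ∈ ((strictTransformIdeal τ (𝓔 ⊔ 𝒦₁) 𝓔 ⊔ strictTransformIdeal τ (𝓔 ⊔ 𝒦₁) 𝒦).support : Set X₂) →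
            stalkIdeal (vanishingIdeal (⟨closure (υ₂ ⁻¹' (E \ Z)), hE'⟩ : Closeds G') ⊔
              vanishingIdeal (⟨closure (closure (υ₂ ⁻¹' (K \ Z))), isClosed_closure⟩ : Closeds G')) y =
            stalkIdeal (vanishingIdeal (⟨closure (υ₂ ⁻¹' (E \ Z)) ∩ closure (closure (υ₂ ⁻¹' (K \ Z))), hE'.inter isClosed_closure⟩ :
              Closeds G')) y →
            IsRegularLocalRing (X₂.presheaf.stalk (j₂ y) ⧸
              stalkIdeal (strictTransformIdeal τ (𝓔 ⊔ 𝒦₁) 𝓔 ⊔ strictTransformIdeal τ (𝓔 ⊔ 𝒦₁) 𝒦) (j₂ y))) ∧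
          IsEffectiveCartier ((strictTransformIdeal τ (𝓔 ⊔ 𝒦₁) 𝓔).comap (strictTransformIdeal τ (𝓔 ⊔ 𝒦₁) 𝒦).subschemeι) ∧
          IsEffectiveCartier ((strictTransformIdeal τ (𝓔 ⊔ 𝒦₁) 𝒦).comap (strictTransformIdeal τ (𝓔 ⊔ 𝒦₁) 𝓔).subschemeι))
    -- S2 the assembly's own stand-in (ruled-surface datum born at a CONE round), for the cone-witnessed sub-case
    (hRootRound : ∀ {F₉ : Scheme.{0}} (Z₉ : Set F₉) (hZ₉ : IsClosed Z₉) {F₁₀ : Scheme.{0}} (υ' : F₁₀ ⟶ F₉)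
        (G G' : Scheme.{0}) (γ : G ⟶ F₁₀) (T : Set G) (Z : Set G) (hZ : IsClosed Z) (υ₂ : G' ⟶ G)
        (X : Scheme.{0}) (σ : X ⟶ P) (S : Set X) (jG : G ⟶ X) (tG : G ⟶ Spec (.of k)) (𝓔 𝒦 : X.IdealSheafData)
        (X'' : Scheme.{0}) (τ : X'' ⟶ X) (j₂ : G' ⟶ X'') (t₂ : G' ⟶ Spec (.of k)),
        Ch X σ S → IsIntegral X → IsLocallyNoetherian X → Scheme.IsRegular X → IsDominant (σ ≫ q) →
        IsPullback jG tG (σ ≫ q) (Spec.map (CommRingCat.ofHom θ)) → jG '' T = S →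
        (𝓔 ⊔ 𝒦).comap jG = vanishingIdeal ⟨Z, hZ⟩ → Flat ((𝓔 ⊔ 𝒦).subschemeι ≫ σ ≫ q) → Scheme.IsRegular (𝓔 ⊔ 𝒦).subscheme →
        Scheme.IsRegular 𝓔.subscheme → IsBlowup τ (𝓔 ⊔ 𝒦) → IsPullback j₂ t₂ ((τ ≫ σ) ≫ q) (Spec.map (CommRingCat.ofHom θ)) →
        j₂ ≫ τ = υ₂ ≫ jG →
        DirLift.Ruled O k θ P q Y F₉ Z₉ hZ₉ F₁₀ υ' G' (υ₂ ≫ γ) (υ₂ ⁻¹' Z) X'' (τ ≫ σ) j₂ ((𝓔 ⊔ 𝒦).comap τ)) :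
    -- ======== the `hCech` binder of `hsub_reachTower_three_of`, VERBATIM ========
    ∀ {F₉ : Scheme.{0}} (Z₉ : Set F₉) (hZ₉ : IsClosed Z₉) {F₁₀ : Scheme.{0}} (υ' : F₁₀ ⟶ F₉)
        (G G' : Scheme.{0}) (γ : G ⟶ F₁₀) (T E K : Set G) (hE : IsClosed E) (Z : Set G) (hZ : IsClosed Z) (υ₂ : G' ⟶ G) (K' : Set G'),
        (Tower.Inv₂ O k θ P q Y Ch (DirLift.Ruled O k θ P q Y) F₉ Z₉ hZ₉ F₁₀ υ' G γ T E K ∧ IsClosed K ∧ K ⊆ closure (K \ E) ∧ K ≠ Set.univ) →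
        Z ⊆ E ∩ T → Z.Nonempty → TowerFull F₉ F₁₀ υ' Z₉ hZ₉ G γ Z hZ →
        (DirStepSec F₉ F₁₀ υ' Z₉ hZ₉ G γ Z hZ ∧ RationalCarrier (redSub F₉ Z₉ hZ₉) ∧
          (∀ x : redSub G Z hZ, IsRegularLocalRing (G.presheaf.stalk (redSubι G Z hZ x))) ∧
          (∀ (i : redSub G Z hZ ⟶ redSub G E hE), i ≫ redSubι G E hE = redSubι G Z hZ →
            ∀ x : redSub G Z hZ, IsRegularLocalRing ((redSub G E hE).presheaf.stalk (i x))) ∧ DirStepUnobs G E hE Z hZ) →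
        IsBlowup υ₂ (vanishingIdeal (⟨Z, hZ⟩ : Closeds G)) →
        (K' = ∅ ∨ ((ConeWitness G E hE K Z hZ ∨ closure (Z \ closure K) = Z) ∧ K' = closure (υ₂ ⁻¹' (K \ Z)))) →
        (Tower.Inv₂ O k θ P q Y Ch (DirLift.Ruled O k θ P q Y) F₉ Z₉ hZ₉ F₁₀ υ' G' (υ₂ ≫ γ) (closure (υ₂ ⁻¹' (T \ Z))) (υ₂ ⁻¹' Z) K' ∧
            IsClosed K' ∧ K' ⊆ closure (K' \ υ₂ ⁻¹' Z) ∧ K' ≠ Set.univ) ∧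
          (Tower.Inv₂ O k θ P q Y Ch (DirLift.Ruled O k θ P q Y) F₉ Z₉ hZ₉ F₁₀ υ' G' (υ₂ ≫ γ) (closure (υ₂ ⁻¹' (T \ Z))) (closure (υ₂ ⁻¹' (E \ Z))) K' ∧
            IsClosed K' ∧ K' ⊆ closure (K' \ closure (υ₂ ⁻¹' (E \ Z))) ∧ K' ≠ Set.univ) :=
  Tower.hCech_of₃ O k θ hθ P q hqprop Y hYirr hYcl hPnoeth hPreg Ch hChain hStep
    (Tower.hCentre_of_root O k θ hθ P q Y Ch hRootCentre) hShadow hShadowOld hRootRound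



end Summit.ResolutionOfSingularities.ResolutionOfSingularities.Cruxes.EquisingularLiftNat.Sections

end
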